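import Summits.ABC.ABC.Theses.DefiniteXi
import Summits.ABC.ABC.Theorems.DefiniteXiXiBoundUpgrade
import HarnessLib

/-!
# Line `SplitProof` — skeleton v5 (route mirror) for the crux `XiStrongBound` (stmt-ABC-11337)

Lead: prover-line-stmt-ABC-11337-c12-0 (continuation c12, re-audit HONEST-BET), 2026-08-17 (v5 unchanged since c10; re-owned).
Card `eisenstein-part-quarantine`; supersedes the tree copy v4 (lead c1, 2026-08-16T10:29Z), whose stub A′
`stub_eisensteinQuarantineSemistable` is FALSE modulo `ProthDepthFamily`
(`Theorems/XiStrongBound/Negative/SplitProofEisensteinQuarantineSemistableFalseOfProthDepthFamily.lean`, p134089).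

## Shape

Since route rev 12 the crux is, by landed algebra, the conjunction of the two route binders of `closes`:

* `stub_eisensteinQuarantine : EisensteinQuarantine` BY NAME = item stmt-ABC-15023 (abc-free as intended; census-FALSE
  AS FILED — Proth–Legendre depth `2^{s−2} ∣ ξ(N/p,p)`, kit j017527; `¬` kernel-checked modulo `ProthDepthFamily` p107816,
  `ForcedPairDepthLaw` p134266, `EtaTwoDepthLaw ∧ supply` p135617; ruling pending: restate to `QuarantineWith D`);
* `stub_steinbergCore : SteinbergCore` BY NAME = item stmt-ABC-15024 (abc-strength; line `p6_tamagawa_split`);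
* composition `XiStrongBound_of` = `DefiniteXiXiBoundUpgrade.xiStrongBound_of_eisensteinQuarantine_of_steinbergCore`.

Both stubs are separately staffed route items, so this line waves no workers; any proof of either item closes the
corresponding stub verbatim.  When the ruling replaces `EisensteinQuarantine` by `QuarantineWith D` (and `SteinbergCore`
by `CoreWith D`), the stubs are re-seamed to those and the composition becomes the landed
`Theorems/DefiniteXiXiStrongBoundReseam.lean` glue; this seat (c12) lands the degree calibration `XiStrongBound(Prime) ⟺ FreyDegreeBound` modulo in-print facts (`Theorems/DefiniteXiXiStrongBoundPrimeCalibration.lean`, `…DegreeCalibration.lean`).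
-/

-- `Summit.<Summit>.<Problem>`: for the single-conjunct summit `ABC` the duplicate `ABC.ABC` is mandated.
set_option linter.dupNamespace false

namespace Summit.ABC.ABC.Cruxes.XiStrongBound.SplitProof

open Summit.ABC.ABC.Theses.DefiniteXi

/-! ### The two registered stubs (= route items) -/

/-- **Stub A** — the route binder `EisensteinQuarantine` (item stmt-ABC-15023) BY NAME:
`sixPart ξ(E;N/Nm,Nm) ≤ C_ε N^ε · ∏_{q ∣ N, q ∤ Nm} v_q(Δ_min)`.  Census-false as filed (see module docstring);
kept by name so that the item's restatement/closure is this stub's. [folklore] -/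
theorem stub_eisensteinQuarantine : Summit.ABC.ABC.Theses.DefiniteXi.EisensteinQuarantine := by
  sorry

/-- **Stub B** — the route binder `SteinbergCore` (item stmt-ABC-15024) BY NAME:
`coprimeSixPart ξ · ∏_{q ∣ N} v_q(Δ_min) ≤ C_ε N^{2+ε}` (abc-strength). [folklore] -/
theorem stub_steinbergCore : Summit.ABC.ABC.Theses.DefiniteXi.SteinbergCore := by
  sorry

/-! ### Composition -/

/-- **The crux from the two stubs** — the rev-12 algebra `ξ = sixPart ξ · coprimeSixPart ξ`,
`∏_{q∣N} v_q = ∏_{q∣N,q∤Nm} v_q · ∏_{q∣Nm} v_q`, landed as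
`DefiniteXiXiBoundUpgrade.xiStrongBound_of_eisensteinQuarantine_of_steinbergCore`. [folklore] -/
theorem XiStrongBound_of : Summit.ABC.ABC.Theses.DefiniteXi.XiStrongBound :=
  Summit.ABC.ABC.Theorems.DefiniteXiXiBoundUpgrade.xiStrongBound_of_eisensteinQuarantine_of_steinbergCore
    stub_eisensteinQuarantine stub_steinbergCore

end Summit.ABC.ABC.Cruxes.XiStrongBound.SplitProof
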